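import Mathlib
import Summits.ValiantsHypothesis.ValiantsHypothesis.Theorems.LiouvilleSarnakLiouvilleCutRankHammingBall
import Summits.ValiantsHypothesis.ValiantsHypothesis.Theorems.LiouvilleSarnakDigitalBilinearLiouvilleSwapStability

/-!
# Route LiouvilleSarnak — crux `DigitalBilinearLiouville` (stmt-ValiantsHypothesis-14774):
# the digital bilinear bound moves by at most `16^{D}` between cuts at Hamming distance `2D`

Companion of `…LiouvilleCutRank.HammingBall` (rank, factor `4^D`) for the operator-norm crux:

* ★ `exists_swaps_range_eq` — for ANY two cuts `π, π'` of the same `2n` positions there is a list of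
  `D(π,π')` row/column swaps (`D` = number of row positions of `π` that are column positions of `π'`) after
  which `π` has exactly the row-position SET of `π'` (the pairing used inside
  `HammingBall.rank_le_pow_card_mul_rank`, exported once and for all).
* `bilinear_sumCongr_eq` / `bilinear_sq_le_of_sumCongr` — relabelling row and column bits re-indexes the test
  vectors bijectively, so a uniform bilinear bound is relabelling-invariant (any entry function `g`).
* ★ `bilinear_sq_le_of_near` — if `|B_{π'}(u,w)|² ≤ K ‖u‖²‖w‖²` for all `u, w`, then
  `|B_π(u,w)|² ≤ 16^{D(π,π')} K ‖u‖²‖w‖²` for all `u, w`.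
* `eventually_bilinear_of_near` — HAMMING-BALL CLOSURE of the `DigitalBilinearLiouville` bound: a family of
  cuts satisfying it uniformly (`∀ ε ∃ n₀ …`) still does after enlarging it by all cuts at distance `≤ d`
  (`ε / 16^d`).

Honest framing: structural (no base class for 14774 is known; the aligned Type-II statement is open); it
says that a counterexample family and a (future) solved class are both unions of Hamming balls of every fixed
radius.  `DigitalBilinearLiouville`, `LiouvilleCutRank`, `AlgebraicSarnak` stay OPEN; nothing bears on
`VP ≠ VNP`.  No definitions.
-/

set_option linter.dupNamespace false

noncomputable section

namespace Summit.ValiantsHypothesis.ValiantsHypothesis.Theorems.LiouvilleSarnakDigitalBilinearLiouville.HammingBall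

open ArithmeticFunction Finset

open Summit.ValiantsHypothesis.ValiantsHypothesis.Theorems.LiouvilleSarnakLiouvilleCutRank.HammingBall
  (card_rowPositions exists_inr_of_not_mem_rowPositions card_rowsNotRows_eq)
open Summit.ValiantsHypothesis.ValiantsHypothesis.Theorems.LiouvilleSarnakLiouvilleCutRank.DefectiveWindow
  (foldr_swaps_apply_inl_of_not_mem foldr_swaps_apply_of_mem)
open Summit.ValiantsHypothesis.ValiantsHypothesis.Theorems.LiouvilleSarnakLiouvilleCutRank.CutRelabel
  (exists_sumCongr_of_range_inl_eq)
open Summit.ValiantsHypothesis.ValiantsHypothesis.Theorems.LiouvilleSarnakDigitalBilinearLiouville.SwapStability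
  (bilinear_sq_le_of_swaps)

/-! ### §1 Swapping to a prescribed row-position set -/

/-- ★ **Swaps realising any row-position set.**  For two cuts `π, π'` of the same `2n` positions there is a
swap list of length `D(π, π')` (the number of row positions of `π` that are not row positions of `π'`) after
which the row positions are exactly those of `π'`. [folklore] -/
theorem exists_swaps_range_eq {n : ℕ} (π π' : Fin n ⊕ Fin n ≃ Fin (2 * n)) :
    ∃ Lw : List (Fin n × Fin n),
      Lw.length = ((univ.image fun i : Fin n => π (Sum.inl i)) \
        (univ.image fun i : Fin n => π' (Sum.inl i))).card ∧
      Set.range (fun i : Fin n => π' (Sum.inl i)) =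
        Set.range (fun i : Fin n =>
          (Lw.foldr (fun q e => (Equiv.swap (Sum.inl q.1) (Sum.inr q.2)).trans e) π) (Sum.inl i)) := by
  classical
  set R := univ.image fun i : Fin n => π (Sum.inl i) with hR
  set R' := univ.image fun i : Fin n => π' (Sum.inl i) with hR'
  set Is := univ.filter fun i : Fin n => π (Sum.inl i) ∉ R' with hIs
  set Js := univ.filter fun j : Fin n => π (Sum.inr j) ∈ R' with hJs
  have hIcard : Is.card = (R \ R').card := by
    have himg : R \ R' = Is.image fun i : Fin n => π (Sum.inl i) := by
      ext k
      simp only [mem_sdiff, hR, hIs, mem_image, mem_filter, mem_univ, true_and]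
      constructor
      · rintro ⟨⟨i, rfl⟩, hk⟩; exact ⟨i, hk, rfl⟩
      · rintro ⟨i, hi, rfl⟩; exact ⟨⟨i, rfl⟩, hi⟩
    have hinj : Function.Injective (fun i : Fin n => π (Sum.inl i)) :=
      π.injective.comp Sum.inl_injective
    rw [himg, card_image_of_injective _ hinj]
  have hJcard : Js.card = (R' \ R).card := by
    have himg : R' \ R = Js.image fun j : Fin n => π (Sum.inr j) := by
      ext k
      simp only [mem_sdiff, hJs, mem_image, mem_filter, mem_univ, true_and]
      constructor
      · rintro ⟨hk', hk⟩
        obtain ⟨j, rfl⟩ := exists_inr_of_not_mem_rowPositions π k hk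
        exact ⟨j, hk', rfl⟩
      · rintro ⟨j, hj, rfl⟩
        refine ⟨hj, fun hmem => ?_⟩
        obtain ⟨i, -, hi⟩ := mem_image.mp hmem
        exact Sum.inl_ne_inr (π.injective hi)
    have hinj : Function.Injective (fun j : Fin n => π (Sum.inr j)) :=
      π.injective.comp Sum.inr_injective
    rw [himg, card_image_of_injective _ hinj]
  have hIJ : Is.card = Js.card := by rw [hIcard, hJcard, card_rowsNotRows_eq]
  set Lw : List (Fin n × Fin n) := Is.toList.zip Js.toList with hLw
  have hlen1 : Is.toList.length = Js.toList.length := by rw [length_toList, length_toList, hIJ]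
  have hfst : Lw.map Prod.fst = Is.toList := by
    rw [hLw]; exact List.map_fst_zip (le_of_eq hlen1)
  have hsnd : Lw.map Prod.snd = Js.toList := by
    rw [hLw]; exact List.map_snd_zip (le_of_eq hlen1.symm)
  have h1 : (Lw.map Prod.fst).Nodup := by rw [hfst]; exact nodup_toList _
  have h2 : (Lw.map Prod.snd).Nodup := by rw [hsnd]; exact nodup_toList _
  refine ⟨Lw, ?_, ?_⟩
  · rw [hLw, List.length_zip, hlen1, min_self, length_toList, hJcard, card_rowsNotRows_eq]
  set π₀ := Lw.foldr (fun q e => (Equiv.swap (Sum.inl q.1) (Sum.inr q.2)).trans e) π with hπ₀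
  have hsub : (univ.image fun i : Fin n => π₀ (Sum.inl i)) ⊆ R' := by
    intro k hk
    obtain ⟨i, -, rfl⟩ := mem_image.mp hk
    by_cases hi : i ∈ Lw.map Prod.fst
    · obtain ⟨q, hq, hqi⟩ := List.mem_map.mp hi
      have hmem : (i, q.2) ∈ Lw := by rw [← hqi]; exact hq
      rw [hπ₀, (foldr_swaps_apply_of_mem π Lw h1 h2 i q.2 hmem).1]
      have hj : q.2 ∈ Js := by
        rw [← mem_toList, ← hsnd]
        exact List.mem_map.mpr ⟨q, hq, rfl⟩
      exact (mem_filter.mp hj).2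
    · rw [hπ₀, foldr_swaps_apply_inl_of_not_mem π Lw i hi]
      have hi' : i ∉ Is := by rwa [← mem_toList, ← hfst]
      rw [hIs, mem_filter, not_and] at hi'
      exact not_not.mp (hi' (mem_univ _))
  have heq : (univ.image fun i : Fin n => π₀ (Sum.inl i)) = R' :=
    eq_of_subset_of_card_le hsub (by rw [hR', card_rowPositions, card_rowPositions])
  rw [← Set.image_univ, ← Set.image_univ, ← coe_univ, ← coe_image, ← coe_image, heq]

/-! ### §2 Relabelling invariance of the bilinear bound -/

/-- Relabelling row bits by `σ` and column bits by `τ` re-indexes the bilinear form: with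
`e₁ r = r ∘ σ⁻¹`, `e₂ c = c ∘ τ⁻¹`, `B_{(σ ⊕ τ) ≫ π}(u, w) = B_π(u ∘ e₁⁻¹, w ∘ e₂⁻¹)`. [folklore] -/
theorem bilinear_sumCongr_eq {n : ℕ} (g : (Fin (2 * n) → Bool) → ℂ) (π : Fin n ⊕ Fin n ≃ Fin (2 * n))
    (σ τ : Equiv.Perm (Fin n)) (u w : (Fin n → Bool) → ℂ) :
    (∑ r : Fin n → Bool, ∑ c : Fin n → Bool, u r * w c *
        g (fun k => Sum.elim r c (((Equiv.sumCongr σ τ).trans π).symm k))) =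
      ∑ r : Fin n → Bool, ∑ c : Fin n → Bool,
        u ((Equiv.arrowCongr σ (Equiv.refl Bool)).symm r) *
          w ((Equiv.arrowCongr τ (Equiv.refl Bool)).symm c) * g (fun k => Sum.elim r c (π.symm k)) := by
  classical
  set e₁ : (Fin n → Bool) ≃ (Fin n → Bool) := Equiv.arrowCongr σ (Equiv.refl Bool) with he₁
  set e₂ : (Fin n → Bool) ≃ (Fin n → Bool) := Equiv.arrowCongr τ (Equiv.refl Bool) with he₂
  have hbits : ∀ r c : Fin n → Bool,
      (fun k => Sum.elim r c (((Equiv.sumCongr σ τ).trans π).symm k)) =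
        fun k => Sum.elim (e₁ r) (e₂ c) (π.symm k) := by
    intro r c
    funext k
    simp only [Equiv.symm_trans_apply, Equiv.sumCongr_symm, Equiv.sumCongr_apply]
    rcases π.symm k with i | i
    · simp [he₁, Equiv.arrowCongr]
    · simp [he₂, Equiv.arrowCongr]
  have step : (∑ r : Fin n → Bool, ∑ c : Fin n → Bool, u r * w c *
        g (fun k => Sum.elim r c (((Equiv.sumCongr σ τ).trans π).symm k))) =
      ∑ r : Fin n → Bool, ∑ c : Fin n → Bool,
        (fun r' c' => u (e₁.symm r') * w (e₂.symm c') * g (fun k => Sum.elim r' c' (π.symm k)))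
          (e₁ r) (e₂ c) := by
    refine Finset.sum_congr rfl fun r _ => Finset.sum_congr rfl fun c _ => ?_
    simp only [hbits, Equiv.symm_apply_apply]
  rw [step]
  rw [Equiv.sum_comp e₁ (fun r' => ∑ c : Fin n → Bool,
    (fun r' c' => u (e₁.symm r') * w (e₂.symm c') * g (fun k => Sum.elim r' c' (π.symm k))) r' (e₂ c))]
  refine Finset.sum_congr rfl fun r _ => ?_
  exact Equiv.sum_comp e₂ (fun c' => u (e₁.symm r) * w (e₂.symm c') *
    g (fun k => Sum.elim r c' (π.symm k)))

/-- A uniform bilinear bound is invariant under relabelling. [folklore] -/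
theorem bilinear_sq_le_of_sumCongr {n : ℕ} (g : (Fin (2 * n) → Bool) → ℂ)
    (π : Fin n ⊕ Fin n ≃ Fin (2 * n)) (σ τ : Equiv.Perm (Fin n)) (K : ℝ)
    (h : ∀ u w : (Fin n → Bool) → ℂ,
      ‖∑ r : Fin n → Bool, ∑ c : Fin n → Bool, u r * w c * g (fun k => Sum.elim r c (π.symm k))‖ ^ 2 ≤
        K * (∑ r : Fin n → Bool, ‖u r‖ ^ 2) * (∑ c : Fin n → Bool, ‖w c‖ ^ 2))
    (u w : (Fin n → Bool) → ℂ) :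
    ‖∑ r : Fin n → Bool, ∑ c : Fin n → Bool, u r * w c *
        g (fun k => Sum.elim r c (((Equiv.sumCongr σ τ).trans π).symm k))‖ ^ 2 ≤
      K * (∑ r : Fin n → Bool, ‖u r‖ ^ 2) * (∑ c : Fin n → Bool, ‖w c‖ ^ 2) := by
  rw [bilinear_sumCongr_eq]
  set e₁ : (Fin n → Bool) ≃ (Fin n → Bool) := Equiv.arrowCongr σ (Equiv.refl Bool) with he₁
  set e₂ : (Fin n → Bool) ≃ (Fin n → Bool) := Equiv.arrowCongr τ (Equiv.refl Bool) with he₂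
  have hu : (∑ r : Fin n → Bool, ‖u (e₁.symm r)‖ ^ 2) = ∑ r : Fin n → Bool, ‖u r‖ ^ 2 :=
    Equiv.sum_comp e₁.symm (fun r => ‖u r‖ ^ 2)
  have hw : (∑ c : Fin n → Bool, ‖w (e₂.symm c)‖ ^ 2) = ∑ c : Fin n → Bool, ‖w c‖ ^ 2 :=
    Equiv.sum_comp e₂.symm (fun c => ‖w c‖ ^ 2)
  have := h (fun r => u (e₁.symm r)) (fun c => w (e₂.symm c))
  rw [hu, hw] at this
  exact this

/-! ### §3 The bound between near cuts -/

/-- ★ **`16^{D}` between cuts at distance `D`.**  If `|B_{π'}(u,w)|² ≤ K ‖u‖²‖w‖²` for all `u, w`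
(`K ≥ 0`), then `|B_π(u,w)|² ≤ 16^{D(π,π')} K ‖u‖²‖w‖²` for all `u, w`, `D(π,π')` the number of row positions
of `π` that are column positions of `π'`. [this file] -/
theorem bilinear_sq_le_of_near {n : ℕ} (g : (Fin (2 * n) → Bool) → ℂ)
    (π π' : Fin n ⊕ Fin n ≃ Fin (2 * n)) (K : ℝ) (hK : 0 ≤ K)
    (h : ∀ u w : (Fin n → Bool) → ℂ,
      ‖∑ r : Fin n → Bool, ∑ c : Fin n → Bool, u r * w c * g (fun k => Sum.elim r c (π'.symm k))‖ ^ 2 ≤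
        K * (∑ r : Fin n → Bool, ‖u r‖ ^ 2) * (∑ c : Fin n → Bool, ‖w c‖ ^ 2))
    (u w : (Fin n → Bool) → ℂ) :
    ‖∑ r : Fin n → Bool, ∑ c : Fin n → Bool, u r * w c * g (fun k => Sum.elim r c (π.symm k))‖ ^ 2 ≤
      16 ^ ((univ.image fun i : Fin n => π (Sum.inl i)) \
          (univ.image fun i : Fin n => π' (Sum.inl i))).card *
        K * (∑ r : Fin n → Bool, ‖u r‖ ^ 2) * (∑ c : Fin n → Bool, ‖w c‖ ^ 2) := by
  -- swap `π'` towards the row set of `π`, then relabel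
  obtain ⟨Lw, hlen, hrange⟩ := exists_swaps_range_eq π' π
  set π₀ := Lw.foldr (fun q e => (Equiv.swap (Sum.inl q.1) (Sum.inr q.2)).trans e) π' with hπ₀
  -- `π = (σ ⊕ τ) ≫ π₀`
  obtain ⟨σ, τ, hστ⟩ := exists_sumCongr_of_range_inl_eq n π₀ π hrange.symm
  have h0 : ∀ u w : (Fin n → Bool) → ℂ,
      ‖∑ r : Fin n → Bool, ∑ c : Fin n → Bool, u r * w c * g (fun k => Sum.elim r c (π₀.symm k))‖ ^ 2 ≤
        16 ^ Lw.length * K * (∑ r : Fin n → Bool, ‖u r‖ ^ 2) * (∑ c : Fin n → Bool, ‖w c‖ ^ 2) :=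
    fun u w => bilinear_sq_le_of_swaps g π' Lw K hK h u w
  have h1 := bilinear_sq_le_of_sumCongr g π₀ σ τ (16 ^ Lw.length * K) h0 u w
  rw [← hστ, hlen, card_rowsNotRows_eq] at h1
  exact h1

/-- ★ **Hamming-ball closure of the digital bilinear bound.**  If the cuts with a property `P` satisfy the
bound of `DigitalBilinearLiouville` uniformly, then so do all cuts at distance `D ≤ d` from a cut with `P` at
the same level, for every fixed `d`. [this file] -/
theorem eventually_bilinear_of_near
    (P : ∀ n : ℕ, (Fin n ⊕ Fin n ≃ Fin (2 * n)) → Prop)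
    (h : ∀ ε : ℝ, 0 < ε → ∃ n₀ : ℕ, ∀ n ≥ n₀, ∀ π' : Fin n ⊕ Fin n ≃ Fin (2 * n), P n π' →
      ∀ u w : (Fin n → Bool) → ℂ,
        ‖∑ r : Fin n → Bool, ∑ c : Fin n → Bool, u r * w c *
          ((liouville (Nat.ofBits (fun k : Fin (2 * n) => Sum.elim r c (π'.symm k)) + 1) : ℤ) : ℂ)‖ ^ 2 ≤
        ε * 4 ^ n * (∑ r : Fin n → Bool, ‖u r‖ ^ 2) * (∑ c : Fin n → Bool, ‖w c‖ ^ 2))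
    (d : ℕ) (ε : ℝ) (hε : 0 < ε) : ∃ n₀ : ℕ, ∀ n ≥ n₀, ∀ π π' : Fin n ⊕ Fin n ≃ Fin (2 * n), P n π' →
      ((univ.image fun i : Fin n => π (Sum.inl i)) \ (univ.image fun i : Fin n => π' (Sum.inl i))).card ≤ d →
      ∀ u w : (Fin n → Bool) → ℂ,
        ‖∑ r : Fin n → Bool, ∑ c : Fin n → Bool, u r * w c *
          ((liouville (Nat.ofBits (fun k : Fin (2 * n) => Sum.elim r c (π.symm k)) + 1) : ℤ) : ℂ)‖ ^ 2 ≤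
        ε * 4 ^ n * (∑ r : Fin n → Bool, ‖u r‖ ^ 2) * (∑ c : Fin n → Bool, ‖w c‖ ^ 2) := by
  have hε' : 0 < ε / 16 ^ d := by positivity
  obtain ⟨n₀, hn₀⟩ := h (ε / 16 ^ d) hε'
  refine ⟨n₀, fun n hn π π' hP hd u w => ?_⟩
  have hK : (0 : ℝ) ≤ ε / 16 ^ d * 4 ^ n := by positivity
  have hbase : ∀ u w : (Fin n → Bool) → ℂ,
      ‖∑ r : Fin n → Bool, ∑ c : Fin n → Bool, u r * w c *
        (fun v : Fin (2 * n) → Bool => (((liouville (Nat.ofBits v + 1)) : ℤ) : ℂ))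
          (fun k => Sum.elim r c (π'.symm k))‖ ^ 2 ≤
        ε / 16 ^ d * 4 ^ n * (∑ r : Fin n → Bool, ‖u r‖ ^ 2) * (∑ c : Fin n → Bool, ‖w c‖ ^ 2) :=
    fun u w => hn₀ n hn π' hP u w
  have := bilinear_sq_le_of_near
    (fun v : Fin (2 * n) → Bool => (((liouville (Nat.ofBits v + 1)) : ℤ) : ℂ)) π π'
    (ε / 16 ^ d * 4 ^ n) hK hbase u w
  refine this.trans ?_
  set D := ((univ.image fun i : Fin n => π (Sum.inl i)) \
    (univ.image fun i : Fin n => π' (Sum.inl i))).card with hD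
  have hU0 : 0 ≤ ∑ r : Fin n → Bool, ‖u r‖ ^ 2 := Finset.sum_nonneg fun _ _ => by positivity
  have hV0 : 0 ≤ ∑ c : Fin n → Bool, ‖w c‖ ^ 2 := Finset.sum_nonneg fun _ _ => by positivity
  have h16 : (16 : ℝ) ^ D ≤ 16 ^ d := pow_le_pow_right₀ (by norm_num) hd
  have key : 16 ^ D * (ε / 16 ^ d * 4 ^ n) ≤ ε * 4 ^ n := by
    calc 16 ^ D * (ε / 16 ^ d * 4 ^ n) ≤ 16 ^ d * (ε / 16 ^ d * 4 ^ n) :=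
          mul_le_mul_of_nonneg_right h16 (by positivity)
      _ = ε * 4 ^ n := by field_simp
  calc 16 ^ D * (ε / 16 ^ d * 4 ^ n) * (∑ r : Fin n → Bool, ‖u r‖ ^ 2) *
        (∑ c : Fin n → Bool, ‖w c‖ ^ 2)
      ≤ ε * 4 ^ n * (∑ r : Fin n → Bool, ‖u r‖ ^ 2) * (∑ c : Fin n → Bool, ‖w c‖ ^ 2) :=
        mul_le_mul_of_nonneg_right (mul_le_mul_of_nonneg_right key hU0) hV0

end Summit.ValiantsHypothesis.ValiantsHypothesis.Theorems.LiouvilleSarnakDigitalBilinearLiouville.HammingBall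

end
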